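import Summits.CriticalPhenomena.PercolationContinuityZ3.Theorems.Transplant.FKConnectivityAllQAntipodalTwoSpineDual
import Summits.CriticalPhenomena.PercolationContinuityZ3.Theorems.Transplant.FKConnectivityAllQAntipodalTwoSpineRule
import HarnessLib

/-!
# Two-spine word model of `U¹¹` — the RULE THEOREM AT A PARALLEL TOP (the root word inequality for all shapes, parallel split node)

Helper file (`--supports stmt-CriticalPhenomena-4575`), FK sub-lane `prim-bschramm-fk-2` (gen 16); builds on p205010 (kernel theorem,
internal audit signed; external expert review pending).  No named facts, no sorries, standard axioms.

Memo `bschramm/FROM-fk-2-g15-TWO-SPINE.md` §12.1/§12.3 and blueprint `prim-bschramm-fk-2-g15/BLUEPRINT-U11-LEAN.md` L3.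
**`FK.TwoSpine.dstmt_root_P`**: for `0 < q ≤ 1` and every pair of spine shapes, `DStmt q .P ⟨[((o,o,o,o),0)],[]⟩ oA oB` — the
PARALLEL-top two-spine word inequality.  PROOF: by the word duality `theta_P_eq_dual` (`…TwoSpineDual`) the parallel-top root sum of a
family `S` over the shapes `(oA, oB)` is, up to the positive factor `q^{2·#series positions - 1}`, the SERIES-top root sum over the
kind-exchanged shapes of the family `S'(u', v') = q^{#1-bits} · S(σD u', σD v')`, reindexed along the involution `σD` of `kindWords`;
`σD` maps one-letter flips to one-letter flips and `#1-bits` is a flip invariant, so `S'` is admissible when `S` is, and the series rule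
theorem `dstmt_root_W` (`…TwoSpineRule`) applies.  With the parallel-node bridge this is Conjecture U¹¹ at PARALLEL split nodes.
[cite: Grimmett2006, §3.9 (p. 63); §6.1 (pp. 133–136)]
-/

noncomputable section

namespace Summit.CriticalPhenomena.PercolationContinuityZ3.Theorems

namespace FK

namespace TwoSpine

open X2Word

/-! ### Shape bookkeeping -/

/-- Kind exchange is an involution on shapes. [folklore] -/
theorem map_other_map_other (o : List Kind) : (o.map Kind.other).map Kind.other = o := by
  rw [List.map_map]
  conv_rhs => rw [← List.map_id o]
  refine List.map_congr_left fun k _ => ?_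
  cases k <;> rfl

/-- The number of series letters of a word of shape `o` is the number of series positions of `o`. [folklore] -/
theorem seriesCount_of_mem_kindWords {o : List Kind} {w : List SLetter} (hw : w ∈ kindWords o) :
    seriesCount w = (o.map fun k => if k = Kind.W then 1 else 0).sum := by
  rw [mem_kindWords] at hw
  unfold seriesCount
  rw [← hw, List.map_map]
  rfl

/-- `σD` maps a one-letter up-flip to a one-letter up-flip. [folklore] -/
theorem UpFlip.sdWord {u u' : List SLetter} (h : UpFlip u u') : UpFlip (sdWord u) (sdWord u') := by
  obtain ⟨pre, suf, k, rfl, rfl⟩ := h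
  refine ⟨TwoSpine.sdWord pre, TwoSpine.sdWord suf, k.other, ?_, ?_⟩ <;>
    simp [sdWord_eq_map]

/-- `#1-bits` is invariant under a one-letter up-flip. [folklore] -/
theorem UpFlip.onesCount_eq {u u' : List SLetter} (h : UpFlip u u') : onesCount u' = onesCount u := by
  obtain ⟨pre, suf, k, rfl, rfl⟩ := h
  exact onesCount_eq_of_forall₂_flip
    (List.rel_append (forall₂_lamFlip_refl pre) (List.Forall₂.cons (Or.inr ⟨rfl, rfl⟩) (forall₂_lamFlip_refl suf)))

/-! ### The parallel-top rule theorem -/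

/-- **THE RULE THEOREM AT A PARALLEL TOP — the root two-spine word inequality for ALL shapes, parallel split node**: for `0 < q ≤ 1`,
`DStmt q .P ⟨[((o,o,o,o),0)],[]⟩ oA oB` (from the series-top rule theorem by word duality). [cite: Grimmett2006, §3.9 (p. 63); §6.1 (pp. 133–136)] -/
theorem dstmt_root_P {q : ℝ} (hq0 : 0 < q) (hq1 : q ≤ 1) (oA oB : List Kind) :
    DStmt q .P ⟨[((Mode.o, Mode.o, Mode.o, Mode.o), 0)], []⟩ oA oB := by
  intro S hS
  set N := (oA.map fun k => if k = Kind.W then 1 else 0).sum + (oB.map fun k => if k = Kind.W then 1 else 0).sum with hNdef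
  -- the dual family
  set S' : ℕ → List SLetter → List SLetter → ℝ :=
    fun i u' v' => q ^ (1 + (onesCount (sdWord u') + onesCount (sdWord v'))) * S i (sdWord u') (sdWord v') with hS'
  have hS'adm : Admissible ⟨[((Mode.o, Mode.o, Mode.o, Mode.o), 0)], []⟩ S' := by
    refine ⟨fun i u v => mul_nonneg (pow_nonneg hq0.le _) (hS.nonneg i _ _), fun i u u' v huu' => ?_, fun i u v v' hvv' => ?_,
      fun p hp => by simp at hp⟩
    · simp only [hS']
      rw [(UpFlip.sdWord huu').onesCount_eq]
      exact mul_le_mul_of_nonneg_left (hS.monoA i _ _ _ (UpFlip.sdWord huu')) (pow_nonneg hq0.le _)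
    · simp only [hS']
      rw [(UpFlip.sdWord hvv').onesCount_eq]
      exact mul_le_mul_of_nonneg_left (hS.monoB i _ _ _ (UpFlip.sdWord hvv')) (pow_nonneg hq0.le _)
  have hW := dstmt_root_W hq0.le hq1 (oA.map Kind.other) (oB.map Kind.other) S' hS'adm
  -- the parallel root sum is the series root sum of the dual family, up to `q^{2N}`
  have key : q ^ (2 * N) * dsum q .P ⟨[((Mode.o, Mode.o, Mode.o, Mode.o), 0)], []⟩ oA oB S =
      dsum q .W ⟨[((Mode.o, Mode.o, Mode.o, Mode.o), 0)], []⟩ (oA.map Kind.other) (oB.map Kind.other) S' := by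
    rw [dsum_root, dsum_root, Finset.mul_sum]
    -- push the factor inside and apply the word duality cell by cell
    have inner : ∀ u ∈ kindWords oA, q ^ (2 * N) * ∑ v ∈ kindWords oB, theta q .P (Mode.o, Mode.o, Mode.o, Mode.o) u v * S 0 u v =
        ∑ v ∈ kindWords oB, theta q .W (Mode.o, Mode.o, Mode.o, Mode.o) (sdWord u) (sdWord v) * S' 0 (sdWord u) (sdWord v) := by
      intro u hu
      rw [Finset.mul_sum]
      refine Finset.sum_congr rfl fun v hv => ?_
      have hsc : seriesCount u + seriesCount v = N := by
        rw [seriesCount_of_mem_kindWords hu, seriesCount_of_mem_kindWords hv]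
      have hd := theta_P_eq_dual q u v
      rw [hsc] at hd
      simp only [hS', sdWord_sdWord]
      calc q ^ (2 * N) * (theta q .P (Mode.o, Mode.o, Mode.o, Mode.o) u v * S 0 u v)
          = (q ^ (2 * N) * theta q .P (Mode.o, Mode.o, Mode.o, Mode.o) u v) * S 0 u v := by ring
        _ = _ := by rw [hd]; ring
    rw [Finset.sum_congr rfl inner]
    -- reindex both sums along the involution `σD`
    have reB : ∀ u' : List SLetter, ∑ v ∈ kindWords oB, theta q .W (Mode.o, Mode.o, Mode.o, Mode.o) u' (sdWord v) * S' 0 u' (sdWord v) =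
        ∑ v' ∈ kindWords (oB.map Kind.other), theta q .W (Mode.o, Mode.o, Mode.o, Mode.o) u' v' * S' 0 u' v' := by
      intro u'
      refine Finset.sum_nbij' sdWord sdWord (fun v hv => sdWord_mem_kindWords hv) (fun v' hv' => ?_) (fun v _ => sdWord_sdWord v)
        (fun v' _ => sdWord_sdWord v') (fun v _ => rfl)
      have h := sdWord_mem_kindWords hv'
      rwa [map_other_map_other] at h
    simp_rw [reB]
    refine Finset.sum_nbij' sdWord sdWord (fun u hu => sdWord_mem_kindWords hu) (fun u' hu' => ?_) (fun u _ => sdWord_sdWord u)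
      (fun u' _ => sdWord_sdWord u') (fun u _ => rfl)
    have h := sdWord_mem_kindWords hu'
    rwa [map_other_map_other] at h
  have hpos : 0 < q ^ (2 * N) := pow_pos hq0 _
  refine (mul_nonneg_iff_of_pos_left hpos).1 ?_
  rw [key]
  exact hW

end TwoSpine

end FK

end Summit.CriticalPhenomena.PercolationContinuityZ3.Theorems

end
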